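import Literature.NumberTheory.LFunctions.SchoenfeldZeroSums
import HarnessLib

/-!
# HANDOFF — MOMENTS OF THE KILLED ZEROS MINUS THE LATTICE: `Σ_{0<γ≤T} m(ρ)γ^{n} − Σ_{k≤K} ℓ_k^{n} = −∫_0^T (N(t) − Λ(t))·n t^{n−1} dt` (rh-explicit, track «HANDOFF», seat prove-2 gen9, ATTEMPT-16 Lemma B3 in the kernel form of ATTEMPT-18 (D-2))

HONEST FRAMING. Nothing here bears on the truth of RH; this is zero COUNTING. In ATTEMPT-16 (HOME/handoff/prove-2/ATTEMPT-16.md §3)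
the cumulants `p_j = (1/j)Σ_k(γ_k^{2j} − ℓ_k^{2j})` of the killed configuration control the near-edge profile (Lemma D1); Lemma B3 bounds
them by writing `j·p_j = ∫ t^{2j} dΔ = −2j∫ t^{2j−1}Δ(t)dt` with `Δ(t) = #{killed γ_k ≤ t} − #{lattice ℓ_k ≤ t}` and bounding `|Δ|` by
COUNTING. Per ATTEMPT-18 (D-2) the kernel kills the HEIGHT `T` (the multiset `zerosBetween 0 T`, `K := N(T)`), and the lattice is
`ℓ_k = πk/b`, `1 ≤ k ≤ K`, with counting function `Λ(t) = min(⌊bt/π⌋, K)`. THIS FILE proves, for every exponent `n ≥ 1`: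

* `card_lattice_le` — `#{1 ≤ k ≤ K : πk/b ≤ t} = min(⌊bt/π⌋, K)` (`t ≥ 0`, `b > 0`);
* `sum_lattice_pow_eq_integral` — `Σ_{k≤K} ℓ_k^{n} = ∫_0^T (K − Λ(t))·n t^{n−1} dt` for `T ≥ πK/b`;
* `sum_zeros_pow_eq_integral` — `Σ_{ρ ∈ zerosBetween 0 T} m(ρ)(Im ρ)^{n} = ∫_0^T (N(T) − N(t))·n t^{n−1} dt` (tree partial summation
  `SchoenfeldBound.sum_zerosBetween_eq`);
* **`sum_zeros_pow_sub_sum_lattice_pow`** — with `K = N(T)` and `T ≥ πK/b`: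
  `Σ_ρ m(ρ)(Im ρ)^{n} − Σ_{k≤K} ℓ_k^{n} = −∫_0^T (N(t) − Λ(t))·n t^{n−1} dt`;
* **`abs_sum_zeros_pow_sub_sum_lattice_pow_le`** — hence `|…| ≤ ∫_0^T D(t)·n t^{n−1} dt` whenever `|N(t) − Λ(t)| ≤ D(t)` on `[0, T]`
  (`D` continuous) — the shape Lemma B3 feeds with `D = f + s + 1` below the horizon and `D = m₁` above it.
No `sorry`, standard axioms, no definitions.

References: this track (ATTEMPT-16 §3 Lemma B3; ATTEMPT-18 §1 (D-2)). J. B. Rosser, L. Schoenfeld, Math. Comp. 29 (1975), Lemma 7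
(partial summation against `N`; tree `SchoenfeldBound.sum_zerosBetween_eq`).

(Re-landed byte-identical apart from this line by seat prove-2 gen10, 2026-08-25, to re-queue the module's build on the farm.)
-/

set_option linter.dupNamespace false

noncomputable section

open Real Finset MeasureTheory intervalIntegral

namespace Summit.RiemannHypothesis.RiemannHypothesis.Theorems.Handoff

open Literature.NumberTheory.LFunctions Literature.NumberTheory.LFunctions.SchoenfeldBound

/-! ## The lattice counting function -/

/-- `#{k < K : π(k+1)/b ≤ t} = min(⌊bt/π⌋, K)` for `t ≥ 0`, `b > 0`. [folklore] -/
theorem card_lattice_le {b t : ℝ} (hb : 0 < b) (ht : 0 ≤ t) (K : ℕ) :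
    ((Finset.range K).filter fun k : ℕ => π * ((k + 1 : ℕ) : ℝ) / b ≤ t).card = min ⌊b * t / π⌋₊ K := by
  have hbt : 0 ≤ b * t / π := by positivity
  have hiff : ∀ k : ℕ, π * ((k + 1 : ℕ) : ℝ) / b ≤ t ↔ k < ⌊b * t / π⌋₊ := by
    intro k
    rw [← Nat.add_one_le_iff, Nat.le_floor_iff hbt, div_le_iff₀ hb, le_div_iff₀ Real.pi_pos]
    push_cast
    constructor <;> intro h <;> nlinarith [Real.pi_pos]
  have e : (Finset.range K).filter (fun k : ℕ => π * ((k + 1 : ℕ) : ℝ) / b ≤ t) =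
      (Finset.range K).filter (fun k : ℕ => k < ⌊b * t / π⌋₊) := Finset.filter_congr fun k _ => hiff k
  rw [e, Finset.range_eq_Ico, Finset.Ico_filter_lt, Nat.card_Ico, Nat.sub_zero, min_comm]

/-! ## The lattice moments as an integral -/

/-- `∫_0^ℓ n t^{n−1} dt = ℓ^{n}` (`n ≥ 1`). [folklore] -/
theorem integral_deriv_pow (ℓ : ℝ) {n : ℕ} (hn : 1 ≤ n) :
    ∫ t in (0 : ℝ)..ℓ, (n : ℝ) * t ^ (n - 1) = ℓ ^ n := by
  have h := integral_eq_sub_of_hasDerivAt (a := 0) (b := ℓ) (f := fun t : ℝ => t ^ n) (f' := fun t : ℝ => (n : ℝ) * t ^ (n - 1))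
    (fun t _ => hasDerivAt_pow n t) ((by fun_prop : Continuous fun t : ℝ => (n : ℝ) * t ^ (n - 1)).intervalIntegrable 0 ℓ)
  rw [h, zero_pow (by omega), sub_zero]

/-- **The lattice moments**: for `b > 0`, `n ≥ 1` and `T ≥ πK/b`,
`Σ_{k<K} (π(k+1)/b)^{n} = ∫_0^T (K − min(⌊bt/π⌋, K))·n t^{n−1} dt`. [this track, ATTEMPT-18 (D-2)] -/
theorem sum_lattice_pow_eq_integral {b T : ℝ} (hb : 0 < b) {K n : ℕ} (hn : 1 ≤ n) (hT : π * K / b ≤ T) :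
    ∑ k ∈ Finset.range K, (π * ((k + 1 : ℕ) : ℝ) / b) ^ n =
      ∫ t in (0 : ℝ)..T, ((K : ℝ) - ((min ⌊b * t / π⌋₊ K : ℕ) : ℝ)) * ((n : ℝ) * t ^ (n - 1)) := by
  classical
  have hT0 : 0 ≤ T := le_trans (by positivity) hT
  have hgc : Continuous fun t : ℝ => (n : ℝ) * t ^ (n - 1) := by fun_prop
  -- each lattice moment as `∫_0^T n t^{n−1} − ∫_0^T 1_{ℓ_k ≤ t}·n t^{n−1}`
  have hk : ∀ k ∈ Finset.range K, (π * ((k + 1 : ℕ) : ℝ) / b) ^ n =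
      (∫ t in (0 : ℝ)..T, (n : ℝ) * t ^ (n - 1)) -
        ∫ t in (0 : ℝ)..T, (if π * ((k + 1 : ℕ) : ℝ) / b ≤ t then (1 : ℝ) else 0) * ((n : ℝ) * t ^ (n - 1)) := by
    intro k hk
    have hℓ0 : 0 < π * ((k + 1 : ℕ) : ℝ) / b := by positivity
    have hℓT : π * ((k + 1 : ℕ) : ℝ) / b ≤ T := by
      refine le_trans ?_ hT
      have : ((k + 1 : ℕ) : ℝ) ≤ K := by exact_mod_cast Finset.mem_range.1 hk
      exact div_le_div_of_nonneg_right (mul_le_mul_of_nonneg_left this Real.pi_pos.le) hb.le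
    rw [integral_indicator_mul_eq hℓ0 hℓT hgc.continuousOn,
      ← integral_add_adjacent_intervals (hgc.intervalIntegrable 0 _) (hgc.intervalIntegrable _ T),
      add_sub_cancel_right, integral_deriv_pow _ hn]
  rw [Finset.sum_congr rfl hk, Finset.sum_sub_distrib, Finset.sum_const, Finset.card_range, nsmul_eq_mul]
  have hint : ∀ k ∈ Finset.range K, IntervalIntegrable
      (fun t => (if π * ((k + 1 : ℕ) : ℝ) / b ≤ t then (1 : ℝ) else 0) * ((n : ℝ) * t ^ (n - 1))) volume 0 T := by
    intro k _
    have heq : (fun t => (if π * ((k + 1 : ℕ) : ℝ) / b ≤ t then (1 : ℝ) else 0) * ((n : ℝ) * t ^ (n - 1))) =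
        (Set.Ici (π * ((k + 1 : ℕ) : ℝ) / b)).indicator fun t : ℝ => (n : ℝ) * t ^ (n - 1) := by
      funext t
      by_cases h : π * ((k + 1 : ℕ) : ℝ) / b ≤ t
      · rw [if_pos h, one_mul, Set.indicator_of_mem (show t ∈ Set.Ici _ from h)]
      · rw [if_neg h, zero_mul, Set.indicator_of_notMem (show t ∉ Set.Ici _ from h)]
    rw [intervalIntegrable_iff_integrableOn_Ioc_of_le hT0, heq]
    exact (hgc.integrableOn_Icc.mono_set Set.Ioc_subset_Icc_self).indicator measurableSet_Ici
  have hsum : IntervalIntegrable (fun t => ∑ k ∈ Finset.range K,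
      (if π * ((k + 1 : ℕ) : ℝ) / b ≤ t then (1 : ℝ) else 0) * ((n : ℝ) * t ^ (n - 1))) volume 0 T := by
    have h := IntervalIntegrable.sum (Finset.range K) hint
    refine (intervalIntegrable_congr fun t _ => ?_).1 h
    simp only [Finset.sum_apply]
  rw [← integral_finsetSum hint, ← intervalIntegral.integral_const_mul,
    ← intervalIntegral.integral_sub ((hgc.intervalIntegrable 0 T).const_mul _) hsum]
  refine integral_congr fun t ht => ?_
  rw [Set.uIcc_of_le hT0] at ht
  rw [← Finset.sum_mul, ← sub_mul, Finset.sum_boole, card_lattice_le hb ht.1 K]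

/-! ## The zero moments as an integral -/

/-- **The moments of the zeros below `T`**: `Σ_{ρ ∈ zerosBetween 0 T} m(ρ)(Im ρ)^{n} = ∫_0^T (N(T) − N(t))·n t^{n−1} dt`
(`T ≥ 0`, `n ≥ 1`). [cite: RosserSchoenfeld1975, Lemma 7] -/
theorem sum_zeros_pow_eq_integral {T : ℝ} (hT : 0 ≤ T) {n : ℕ} (hn : 1 ≤ n) :
    ∑ ρ ∈ zerosBetween 0 T, (riemannZetaZeroOrder ρ : ℝ) * ρ.im ^ n =
      ∫ t in (0 : ℝ)..T, ((zetaZeroCount T : ℝ) - zetaZeroCount t) * ((n : ℝ) * t ^ (n - 1)) := by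
  have hgc : Continuous fun t : ℝ => (n : ℝ) * t ^ (n - 1) := by fun_prop
  have h := sum_zerosBetween_eq (T₁ := 0) (T₂ := T) le_rfl hT (f := fun t : ℝ => t ^ n)
    (f' := fun t : ℝ => (n : ℝ) * t ^ (n - 1)) (fun t _ => hasDerivAt_pow n t) hgc.continuousOn
  rw [h]
  simp only [zetaZeroCount_eq_zero_of_nonpos le_rfl, Nat.cast_zero, sub_zero]
  have hN : IntervalIntegrable (fun t : ℝ => (zetaZeroCount t : ℝ)) volume 0 T :=
    Monotone.intervalIntegrable fun s t hst => by exact_mod_cast zetaZeroCount_mono hst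
  have h1 : (zetaZeroCount T : ℝ) * T ^ n = ∫ t in (0 : ℝ)..T, (zetaZeroCount T : ℝ) * ((n : ℝ) * t ^ (n - 1)) := by
    rw [intervalIntegral.integral_const_mul, integral_deriv_pow _ hn]
  rw [h1, ← intervalIntegral.integral_sub ((hgc.intervalIntegrable 0 T).const_mul _)
    (hN.mul_continuousOn hgc.continuousOn)]
  refine integral_congr fun t _ => ?_
  ring

/-! ## Lemma B3, kernel form -/

/-- **ATTEMPT-16 Lemma B3 (kernel form): the moments of the killed zeros minus those of the lattice.** For `b > 0`, `n ≥ 1`,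
`T ≥ 0` with `K := N(T)` and `πK/b ≤ T` (the `K`-th lattice point below the killing height):
`Σ_{ρ ∈ zerosBetween 0 T} m(ρ)(Im ρ)^{n} − Σ_{k<K}(π(k+1)/b)^{n} = −∫_0^T (N(t) − min(⌊bt/π⌋, K))·n t^{n−1} dt`.
[this track, ATTEMPT-16 Lemma B3] -/
theorem sum_zeros_pow_sub_sum_lattice_pow {b T : ℝ} (hb : 0 < b) (hT : 0 ≤ T) {n : ℕ} (hn : 1 ≤ n)
    (hK : π * (zetaZeroCount T) / b ≤ T) :
    (∑ ρ ∈ zerosBetween 0 T, (riemannZetaZeroOrder ρ : ℝ) * ρ.im ^ n) -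
        ∑ k ∈ Finset.range (zetaZeroCount T), (π * ((k + 1 : ℕ) : ℝ) / b) ^ n =
      -∫ t in (0 : ℝ)..T, ((zetaZeroCount t : ℝ) - ((min ⌊b * t / π⌋₊ (zetaZeroCount T) : ℕ) : ℝ)) *
        ((n : ℝ) * t ^ (n - 1)) := by
  have hgc : Continuous fun t : ℝ => (n : ℝ) * t ^ (n - 1) := by fun_prop
  have hN : IntervalIntegrable (fun t : ℝ => (zetaZeroCount t : ℝ)) volume 0 T :=
    Monotone.intervalIntegrable fun s t hst => by exact_mod_cast zetaZeroCount_mono hst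
  have hΛ : IntervalIntegrable (fun t : ℝ => (((min ⌊b * t / π⌋₊ (zetaZeroCount T) : ℕ) : ℝ))) volume 0 T := by
    refine Monotone.intervalIntegrable fun s t hst => ?_
    exact_mod_cast min_le_min_right _ (Nat.floor_le_floor (by
      exact div_le_div_of_nonneg_right (mul_le_mul_of_nonneg_left hst hb.le) Real.pi_pos.le))
  have hc : IntervalIntegrable (fun _ : ℝ => ((zetaZeroCount T : ℕ) : ℝ)) volume 0 T := intervalIntegrable_const
  rw [sum_zeros_pow_eq_integral hT hn, sum_lattice_pow_eq_integral hb hn hK, ← intervalIntegral.integral_neg,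
    ← intervalIntegral.integral_sub ((hc.sub hN).mul_continuousOn hgc.continuousOn)
      ((hc.sub hΛ).mul_continuousOn hgc.continuousOn)]
  refine integral_congr fun t _ => ?_
  ring

/-- **ATTEMPT-16 Lemma B3, the bound (kernel).** Under the same hypotheses, if `|N(t) − min(⌊bt/π⌋, K)| ≤ D(t)` for `t ∈ [0, T]` with `D`
continuous on `[0, T]`, then `|Σ_ρ m(ρ)(Im ρ)^{n} − Σ_{k<K} ℓ_k^{n}| ≤ ∫_0^T D(t)·n t^{n−1} dt`. [this track, ATTEMPT-16 Lemma B3] -/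
theorem abs_sum_zeros_pow_sub_sum_lattice_pow_le {b T : ℝ} (hb : 0 < b) (hT : 0 ≤ T) {n : ℕ} (hn : 1 ≤ n)
    (hK : π * (zetaZeroCount T) / b ≤ T) {D : ℝ → ℝ} (hD : ContinuousOn D (Set.Icc 0 T))
    (hΔ : ∀ t ∈ Set.Icc 0 T, |(zetaZeroCount t : ℝ) - ((min ⌊b * t / π⌋₊ (zetaZeroCount T) : ℕ) : ℝ)| ≤ D t) :
    |(∑ ρ ∈ zerosBetween 0 T, (riemannZetaZeroOrder ρ : ℝ) * ρ.im ^ n) -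
        ∑ k ∈ Finset.range (zetaZeroCount T), (π * ((k + 1 : ℕ) : ℝ) / b) ^ n| ≤
      ∫ t in (0 : ℝ)..T, D t * ((n : ℝ) * t ^ (n - 1)) := by
  rw [sum_zeros_pow_sub_sum_lattice_pow hb hT hn hK, abs_neg]
  have hgc : Continuous fun t : ℝ => (n : ℝ) * t ^ (n - 1) := by fun_prop
  have hN : IntervalIntegrable (fun t : ℝ => (zetaZeroCount t : ℝ)) volume 0 T :=
    Monotone.intervalIntegrable fun s t hst => by exact_mod_cast zetaZeroCount_mono hst
  have hΛ : IntervalIntegrable (fun t : ℝ => (((min ⌊b * t / π⌋₊ (zetaZeroCount T) : ℕ) : ℝ))) volume 0 T := by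
    refine Monotone.intervalIntegrable fun s t hst => ?_
    exact_mod_cast min_le_min_right _ (Nat.floor_le_floor (by
      exact div_le_div_of_nonneg_right (mul_le_mul_of_nonneg_left hst hb.le) Real.pi_pos.le))
  have hIcc : Set.uIcc 0 T = Set.Icc 0 T := Set.uIcc_of_le hT
  calc |∫ t in (0 : ℝ)..T, ((zetaZeroCount t : ℝ) - ((min ⌊b * t / π⌋₊ (zetaZeroCount T) : ℕ) : ℝ)) * ((n : ℝ) * t ^ (n - 1))|
      ≤ ∫ t in (0 : ℝ)..T, |((zetaZeroCount t : ℝ) - ((min ⌊b * t / π⌋₊ (zetaZeroCount T) : ℕ) : ℝ)) * ((n : ℝ) * t ^ (n - 1))| :=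
        abs_integral_le_integral_abs hT
    _ ≤ ∫ t in (0 : ℝ)..T, D t * ((n : ℝ) * t ^ (n - 1)) := by
        refine integral_mono_on hT ((hN.sub hΛ).mul_continuousOn hgc.continuousOn).abs
          ((hD.mul hgc.continuousOn).intervalIntegrable_of_Icc hT) fun t ht => ?_
        have hw : (0 : ℝ) ≤ (n : ℝ) * t ^ (n - 1) := by have := ht.1; positivity
        rw [abs_mul, abs_of_nonneg hw]
        exact mul_le_mul_of_nonneg_right (hΔ t ht) hw

end Summit.RiemannHypothesis.RiemannHypothesis.Theorems.Handoff

end
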